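import Summits.ValiantsHypothesis.ValiantsHypothesis.Theorems.FifoMatchingNNDivisionHardExactPencilTightening
import HarnessLib

/-!
# EXACT PENCILS II — the pair cube `Q_pair`: half-matching `π`, location `W_π`, pin values and scores, the common maximiser `H⋆ = πᶜ` (crux `NNDivisionHard`, stmt-ValiantsHypothesis-21181) — `ExactPencil` port part 2/12

Theorems-side port (staged by val-idea-40 g6, C′-census owner per director-valiant R331 (2)(e) / desk #399, for the port hands;
press as `Theorems/FifoMatchingNNDivisionHardExactPencilQPair.lean`, `--kind proof --supports stmt-ValiantsHypothesis-21181 --as helper`; sig-first val-idea-crit-9 g3) of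
§5 (first half: through `score_le_star`) of val-idea-38 g2's crux workfile `Cruxes/NNDivisionHard/ExactPencil38.lean` REV 16 @4e81d1716f6b (sha16 d9f2e288279a0b09, 3 456 l., FROZEN — final from 38 g2, bus 01:14:51Z; critic of record val-idea-crit-9 g2/g3: `CRITIC-wave6.md` FINAL + V#97 §2 «rev 14/15 δ KERNEL VERIFIED»).  Declaration texts VERBATIM (namespace
`…Theorems.FifoMatching.ExactPencil`; one-line docstrings added where the source had none); the 40-g5 tools the source RESTATED are
DROPPED here and cited BY NAME from the landed ports `…Theorems.FifoMatching.LocatedRows.*` (✓ p680125 … p683387: `T`, `RowFamily`,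
`hCOR`, `exactTilted`, `ExactPencilLaw`, `pinnedRows`, `unflat`, `three_pow_le_of_block`, `two_pow_half_mul_le`, `zgen`, `cubePt`, …) and
`…Theorems.FifoMatching.XcDivision` (`udRow`, `udPt`, `udInd`, `udMat`, …), so that C′ stays ONE Theorems declaration
`LocatedRows.ExactPencilLaw`.  Part 2/12 of the port (imports part 1, `…Theorems.FifoMatchingNNDivisionHardExactPencilTightening`).

* `sum_sum_ite_and_mul`, `flat_dPair_dotProduct_udPt(_le_one)`, `dg_touch₁…₄`, `flatLin`, `kk` (`⌊n/2⌋`), `ι₁`, `ι₂`, `PIdx`, `Matched`,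
  `Wm` (`W_π = Σ_t 3·d_t`), `qPair`, `Hstar`; pin values `dg_matched` (`−6` on `π`), `dg_term_unmatched`, `dg_unmatched` (`≥ 3` off `π`);
  `w_bounds`, `score_neg`, `score_pos`, `dotProduct_qPair`, ★ `score_le_star` (every location row is maximised at `H⋆ = πᶜ`).

HONEST LABEL: every theorem here is a DECIDED SPECIES / support lemma for the OPEN law C′ = `LocatedRows.ExactPencilLaw`
(`exactTilted.Law`); the crux 21181 `NNDivisionHard`, C′, `allRows.Law` and COR-VIRTUAL are OPEN; C⁺_entry `LocatedPencilLaw` is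
REFUTED (✓ p679540).  VP ≠ VNP is NOT proved here or anywhere in this tree.
-/

set_option autoImplicit false

-- the mandated summit-side namespace repeats a component by design (single-problem summit)
set_option linter.dupNamespace false

noncomputable section

open Matrix Finset
open scoped Pointwise

namespace Summit.ValiantsHypothesis.ValiantsHypothesis.Theorems.FifoMatching.ExactPencil

open Literature.Barriers.PneNP (HasEFOfSize three_pow_le_card_mul_two_pow_of_cover_univ)
open Literature.Combinatorics.Optimization.FixedSizePsdRank
  (corPolytope flat vecOuter flat_dotProduct_le_of_mem_corPolytope flat_dotProduct_vecOuter)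
open Summit.ValiantsHypothesis.ValiantsHypothesis.Theorems.FifoMatching.XcDivision
  (udRow udPt udInd udMat ud_data udInd_apply udInd_sq dot_le_of_mem_convexHull flat_dotProduct_flat)
open Summit.ValiantsHypothesis.ValiantsHypothesis.Theorems.FifoMatching.LocatedRows
  (T CorVirtualHardN RowFamily corVirtualHardN_of_law flat_le_box entryTilted allRows LocatedPencilLaw
    hCOR le_hCOR exists_eq_hCOR flat_le_hCOR hCOR_le_box exactTilted ExactPencilLaw exactTilted_emb_allRows
    corVirtualHardN_of_exactPencilLaw three_pow_le_of_block two_pow_half_mul_le pinnedRows unflat flat_unflat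
    pinnedRows_emb_exactTilted corVirtualHardN_of_pinnedRowsLaw zgen cubePt dotProduct_cubePt)

/-! ## §5 The exact pairing read DECIDES the pair cube — `exactTilted.Law` on `Q_pair`, in the Law's own currency -/

section QPair
variable {n : ℕ}

/-- `g_{jm} = g_{mj}`. -/
theorem gPair_comm (j m : Fin n) : gPair j m = gPair m j := by
  funext i i'; simp only [gPair]; ring

/-- `d_{jj'} = d_{j'j}`. -/
theorem dPair_comm (j j' : Fin n) : dPair j j' = dPair j' j := by
  funext i i'; simp only [dPair]; ring

/-- pick out one entry (left factor version). -/
theorem sum_sum_ite_and_mul (f : Fin n → Fin n → ℝ) (c : ℝ) (j m : Fin n) :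
    ∑ i, ∑ i', (if i = j ∧ i' = m then c else 0) * f i i' = c * f j m := by
  have : ∀ i i' : Fin n, (if i = j ∧ i' = m then c else 0) * f i i' =
      if i' = m then (if i = j then c * f i i' else 0) else 0 := by
    intro i i'
    by_cases hi : i = j <;> by_cases hi' : i' = m <;> simp [hi, hi']
  simp_rw [this]
  simp only [Finset.sum_ite_eq', Finset.mem_univ, if_true]

/-- `⟨d_jj', x_b⟩ = (b_j − b_j')² = [b splits {j,j'}]`. -/
theorem flat_dPair_dotProduct_udPt {j j' : Fin n} (b : Finset (Fin n)) :
    flat (dPair j j') ⬝ᵥ udPt b = (udInd b j - udInd b j') ^ 2 := by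
  show flat (dPair j j') ⬝ᵥ vecOuter n (udInd b) = _
  rw [flat_dotProduct_vecOuter]
  simp only [dPair, add_mul, Finset.sum_add_distrib, sum_sum_ite_and_mul]
  ring

/-- `⟨d_{jj'}, x_b⟩ ≤ 1` at every vertex `x_b` of `COR(n)`. -/
theorem flat_dPair_dotProduct_udPt_le_one {j j' : Fin n} (b : Finset (Fin n)) :
    flat (dPair j j') ⬝ᵥ udPt b ≤ 1 := by
  rw [flat_dPair_dotProduct_udPt]
  rw [udInd_apply, udInd_apply]
  split_ifs <;> norm_num

/-- touch variants of the pin value `+1` (shared vertex in any position). -/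
theorem dg_touch₁ {p p' m : Fin n} (hpp : p ≠ p') (hm : m ≠ p) (hm' : m ≠ p') :
    flat (dPair p p') ⬝ᵥ flat (gPair p m) = 1 := flat_dPair_dotProduct_gPair_touch hpp hm hm'

/-- `⟨d_{pp'}, g_{jp}⟩ = 1` (touching at `p`, second slot). -/
theorem dg_touch₂ {p p' j : Fin n} (hpp : p ≠ p') (hj : j ≠ p) (hj' : j ≠ p') :
    flat (dPair p p') ⬝ᵥ flat (gPair j p) = 1 := by
  rw [gPair_comm]; exact flat_dPair_dotProduct_gPair_touch hpp hj hj'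

/-- `⟨d_{pp'}, g_{p'm}⟩ = 1` (touching at `p'`, first slot). -/
theorem dg_touch₃ {p p' m : Fin n} (hpp : p ≠ p') (hm : m ≠ p') (hm' : m ≠ p) :
    flat (dPair p p') ⬝ᵥ flat (gPair p' m) = 1 := by
  rw [dPair_comm]; exact flat_dPair_dotProduct_gPair_touch hpp.symm hm hm'

/-- `⟨d_{pp'}, g_{jp'}⟩ = 1` (touching at `p'`, second slot). -/
theorem dg_touch₄ {p p' j : Fin n} (hpp : p ≠ p') (hj : j ≠ p') (hj' : j ≠ p) :
    flat (dPair p p') ⬝ᵥ flat (gPair j p') = 1 := by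
  rw [dPair_comm, gPair_comm]; exact flat_dPair_dotProduct_gPair_touch hpp.symm hj hj'

/-- `flat` is linear. -/
def flatLin (n : ℕ) : Matrix (Fin n) (Fin n) ℝ →ₗ[ℝ] (Fin (n * n) → ℝ) where
  toFun := flat
  map_add' := fun _ _ => rfl
  map_smul' := fun _ _ => rfl

/-! ### the half-matching, the location `W_π`, the passenger `Q_pair` -/

/-- `k = ⌊n/2⌋`. -/
def kk (n : ℕ) : ℕ := n / 2

/-- left endpoints `t ↦ t`. -/
def ι₁ (t : Fin (kk n)) : Fin n := ⟨t, by have := t.2; unfold kk at this; omega⟩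

/-- right endpoints `t ↦ t + k`. -/
def ι₂ (t : Fin (kk n)) : Fin n := ⟨t + kk n, by have := t.2; simp only [kk] at this ⊢; omega⟩

/-- the value of `ι₁ t` is `t`. -/
@[simp] theorem ι₁_val (t : Fin (kk n)) : ((ι₁ t : Fin n) : ℕ) = t := rfl
/-- the value of `ι₂ t` is `t + ⌊n/2⌋`. -/
@[simp] theorem ι₂_val (t : Fin (kk n)) : ((ι₂ t : Fin n) : ℕ) = t + kk n := rfl

/-- the two halves are disjoint: `ι₁ t ≠ ι₂ s`. -/
theorem ι₁_ne_ι₂ (t s : Fin (kk n)) : ι₁ t ≠ ι₂ s := by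
  intro h; have := congrArg Fin.val h; simp at this; omega

/-- `ι₁` is injective. -/
theorem ι₁_injective : Function.Injective (ι₁ (n := n)) := by
  intro t s h; have := congrArg Fin.val h; simp at this; exact Fin.ext this

/-- `ι₂` is injective. -/
theorem ι₂_injective : Function.Injective (ι₂ (n := n)) := by
  intro t s h; have := congrArg Fin.val h; simp at this; exact Fin.ext (by omega)

/-- ordered pairs `j < m` (the edges of `K_n`). -/
abbrev PIdx (n : ℕ) := {p : Fin n × Fin n // p.1 < p.2}

/-- `e` is a matched pair `(t, t+k)`. -/
abbrev Matched (e : PIdx n) : Prop := (e.1.1 : ℕ) < kk n ∧ (e.1.2 : ℕ) = e.1.1 + kk n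

/-- the location: `W_π = 3·Σ_t d_{ι₁ t, ι₂ t}`. -/
noncomputable def Wm (n : ℕ) : Matrix (Fin n) (Fin n) ℝ := ∑ t : Fin (kk n), (3 : ℝ) • dPair (ι₁ t) (ι₂ t)

/-- `flat W_π = Σ_t 3 • flat d_t` (linearity of `flat`). -/
theorem flat_Wm : flat (Wm n) = ∑ t : Fin (kk n), (3 : ℝ) • flat (dPair (ι₁ t) (ι₂ t)) := by
  change flatLin n (Wm n) = ∑ t : Fin (kk n), (3 : ℝ) • flatLin n (dPair (ι₁ t) (ι₂ t))
  unfold Wm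
  rw [map_sum]
  simp_rw [map_smul]

/-- `⟨W_π, v⟩ = Σ_t 3·⟨d_t, v⟩`. -/
theorem flat_Wm_dotProduct (v : Fin (n * n) → ℝ) :
    flat (Wm n) ⬝ᵥ v = ∑ t : Fin (kk n), 3 * (flat (dPair (ι₁ t) (ι₂ t)) ⬝ᵥ v) := by
  rw [flat_Wm, sum_dotProduct]
  simp_rw [smul_dotProduct, smul_eq_mul]

/-- the vertex `q_H = Σ_{e ∈ H} g_e` of the pair cube. -/
noncomputable def qPair (H : Finset (PIdx n)) : Fin (n * n) → ℝ := ∑ e ∈ H, flat (gPair e.1.1 e.1.2)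

/-- the common maximising column `H⋆ = πᶜ`. -/
noncomputable def Hstar (n : ℕ) : Finset (PIdx n) := Finset.univ.filter (fun e => ¬ Matched e)

/-! ### the pin values `D(e) = Σ_t ⟨d_t, g_e⟩`: `−2` on `π`, `∈ {0,1}` termwise and `≥ 1` off `π` -/

/-- the pin value on a MATCHED pair: `⟨W_π, g_e⟩ = −6` for `e ∈ π`. -/
theorem dg_matched (e : PIdx n) (he : Matched e) :
    flat (Wm n) ⬝ᵥ flat (gPair e.1.1 e.1.2) = -6 := by
  obtain ⟨h1, h2⟩ := he
  rw [flat_Wm_dotProduct]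
  set s : Fin (kk n) := ⟨e.1.1, h1⟩ with hs
  have he1 : ι₁ s = e.1.1 := Fin.ext (by simp [hs])
  have he2 : ι₂ s = e.1.2 := Fin.ext (by simp [hs]; omega)
  rw [Finset.sum_eq_single s]
  · rw [← he1, ← he2, flat_dPair_dotProduct_gPair_self (ι₁_ne_ι₂ s s)]; norm_num
  · intro t _ hts
    have h11 : ι₁ t ≠ e.1.1 := by rw [← he1]; exact fun h => hts (ι₁_injective h)
    have h12 : ι₁ t ≠ e.1.2 := by rw [← he2]; exact ι₁_ne_ι₂ t s
    have h21 : ι₂ t ≠ e.1.1 := by rw [← he1]; exact (ι₁_ne_ι₂ s t).symm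
    have h22 : ι₂ t ≠ e.1.2 := by rw [← he2]; exact fun h => hts (ι₂_injective h)
    rw [flat_dPair_dotProduct_gPair_disjoint h11.symm h21.symm h12.symm h22.symm]; ring
  · intro h; exact absurd (Finset.mem_univ s) h

/-- termwise: for an unmatched edge every pair term is `0` or `1`. -/
theorem dg_term_unmatched (e : PIdx n) (he : ¬ Matched e) (t : Fin (kk n)) :
    flat (dPair (ι₁ t) (ι₂ t)) ⬝ᵥ flat (gPair e.1.1 e.1.2) = 0 ∨
      flat (dPair (ι₁ t) (ι₂ t)) ⬝ᵥ flat (gPair e.1.1 e.1.2) = 1 := by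
  have hjm : e.1.1 ≠ e.1.2 := ne_of_lt e.2
  have hlt : (e.1.1 : ℕ) < e.1.2 := e.2
  have hpp : ι₁ t ≠ ι₂ t := ι₁_ne_ι₂ t t
  by_cases a1 : ι₁ t = e.1.1
  · by_cases a4 : ι₂ t = e.1.2
    · exfalso; apply he
      have h1 := congrArg Fin.val a1; have h2 := congrArg Fin.val a4; simp at h1 h2
      have := t.2
      exact ⟨by omega, by omega⟩
    · right
      have hm : e.1.2 ≠ ι₁ t := by rw [a1]; exact hjm.symm
      have hm' : e.1.2 ≠ ι₂ t := fun h => a4 h.symm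
      rw [← a1]; exact dg_touch₁ hpp hm hm'
  · by_cases a2 : ι₁ t = e.1.2
    · by_cases a3 : ι₂ t = e.1.1
      · exfalso
        have h1 := congrArg Fin.val a2; have h2 := congrArg Fin.val a3; simp at h1 h2; omega
      · right
        have hj : e.1.1 ≠ ι₁ t := fun h => a1 h.symm
        have hj' : e.1.1 ≠ ι₂ t := fun h => a3 h.symm
        rw [← a2]; exact dg_touch₂ hpp hj hj'
    · by_cases a3 : ι₂ t = e.1.1
      · right
        have hm : e.1.2 ≠ ι₂ t := by rw [a3]; exact hjm.symm
        have hm' : e.1.2 ≠ ι₁ t := fun h => a2 h.symm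
        rw [← a3]; exact dg_touch₃ hpp hm hm'
      · by_cases a4 : ι₂ t = e.1.2
        · right
          have hj : e.1.1 ≠ ι₂ t := fun h => a3 h.symm
          have hj' : e.1.1 ≠ ι₁ t := fun h => a1 h.symm
          rw [← a4]; exact dg_touch₄ hpp hj hj'
        · left
          exact flat_dPair_dotProduct_gPair_disjoint (fun h => a1 h.symm) (fun h => a3 h.symm)
            (fun h => a2 h.symm) (fun h => a4 h.symm)

/-! ### scores and the common maximiser `H⋆` -/

/-- `n ≤ 2·⌊n/2⌋ + 1`. -/
theorem two_kk_succ (n : ℕ) : n ≤ kk n + kk n + 1 := by unfold kk; omega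

/-- off `π`: `D(e) = ⟨W_π, g_e⟩ ≥ 3`. -/
theorem dg_unmatched (e : PIdx n) (he : ¬ Matched e) : 3 ≤ flat (Wm n) ⬝ᵥ flat (gPair e.1.1 e.1.2) := by
  have hjm : e.1.1 ≠ e.1.2 := ne_of_lt e.2
  have hlt : (e.1.1 : ℕ) < e.1.2 := e.2
  have h2 : (e.1.2 : ℕ) < n := e.1.2.2
  have hk := two_kk_succ n
  rw [flat_Wm_dotProduct]
  have hnonneg : ∀ t ∈ (Finset.univ : Finset (Fin (kk n))),
      0 ≤ 3 * (flat (dPair (ι₁ t) (ι₂ t)) ⬝ᵥ flat (gPair e.1.1 e.1.2)) := by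
    intro t _
    rcases dg_term_unmatched e he t with h | h <;> rw [h] <;> norm_num
  -- the pair `t₀` containing the (matched) vertex `e.1.1`
  by_cases hj : (e.1.1 : ℕ) < kk n
  · let t₀ : Fin (kk n) := ⟨e.1.1, hj⟩
    have h1 : ι₁ t₀ = e.1.1 := Fin.ext (by simp [t₀])
    have hval : flat (dPair (ι₁ t₀) (ι₂ t₀)) ⬝ᵥ flat (gPair e.1.1 e.1.2) = 1 := by
      have hm : e.1.2 ≠ ι₁ t₀ := by rw [h1]; exact hjm.symm
      have hm' : e.1.2 ≠ ι₂ t₀ := by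
        intro h; apply he
        have := congrArg Fin.val h; simp [t₀] at this
        exact ⟨hj, by omega⟩
      conv_lhs => rw [← h1]
      exact dg_touch₁ (ι₁_ne_ι₂ t₀ t₀) hm hm'
    have := Finset.single_le_sum hnonneg (Finset.mem_univ t₀)
    rw [hval] at this
    linarith
  · have hj2 : (e.1.1 : ℕ) - kk n < kk n := by omega
    let t₀ : Fin (kk n) := ⟨e.1.1 - kk n, hj2⟩
    have h1 : ι₂ t₀ = e.1.1 := Fin.ext (by simp [t₀]; omega)
    have hval : flat (dPair (ι₁ t₀) (ι₂ t₀)) ⬝ᵥ flat (gPair e.1.1 e.1.2) = 1 := by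
      have hm : e.1.2 ≠ ι₂ t₀ := by rw [h1]; exact hjm.symm
      have hm' : e.1.2 ≠ ι₁ t₀ := by
        intro h; have := congrArg Fin.val h; simp [t₀] at this; omega
      conv_lhs => rw [← h1]
      exact dg_touch₃ (ι₁_ne_ι₂ t₀ t₀) hm hm'
    have := Finset.single_le_sum hnonneg (Finset.mem_univ t₀)
    rw [hval] at this
    linarith

/-- the clique weights are in `[−2, 1]`. -/
theorem w_bounds (a : Finset (Fin n)) (e : PIdx n) :
    -2 ≤ udRow a ⬝ᵥ flat (gPair e.1.1 e.1.2) ∧ udRow a ⬝ᵥ flat (gPair e.1.1 e.1.2) ≤ 1 := by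
  rw [udRow_dotProduct_gPair a (ne_of_lt e.2), udInd_apply, udInd_apply]
  split_ifs <;> norm_num

/-- the located row `(a, W_π)` scores every generator: negative on `π`, positive off `π`. -/
theorem score_neg (a : Finset (Fin n)) (e : PIdx n) (he : Matched e) :
    (udRow a + flat (Wm n)) ⬝ᵥ flat (gPair e.1.1 e.1.2) < 0 := by
  rw [add_dotProduct, dg_matched e he]; linarith [(w_bounds a e).2]

/-- scores of unmatched pairs are POSITIVE for every clique row `a`. -/
theorem score_pos (a : Finset (Fin n)) (e : PIdx n) (he : ¬ Matched e) :
    0 < (udRow a + flat (Wm n)) ⬝ᵥ flat (gPair e.1.1 e.1.2) := by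
  rw [add_dotProduct]; linarith [(w_bounds a e).1, dg_unmatched e he]

/-- `⟨ρ, q_H⟩ = Σ_{e∈H} ⟨ρ, g_e⟩`. -/
theorem dotProduct_qPair (ρ : Fin (n * n) → ℝ) (H : Finset (PIdx n)) :
    ρ ⬝ᵥ qPair H = ∑ e ∈ H, ρ ⬝ᵥ flat (gPair e.1.1 e.1.2) := by
  unfold qPair; rw [dotProduct_sum]

/-- ★ `H⋆ = πᶜ` maximises EVERY located row `(a, W_π)` over the pair cube. -/
theorem score_le_star (a : Finset (Fin n)) (H : Finset (PIdx n)) :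
    (udRow a + flat (Wm n)) ⬝ᵥ qPair H ≤ (udRow a + flat (Wm n)) ⬝ᵥ qPair (Hstar n) := by
  classical
  set ρ := udRow a + flat (Wm n)
  rw [dotProduct_qPair, dotProduct_qPair]
  have hsplit := Finset.sum_filter_add_sum_filter_not H (fun e => Matched e)
    (fun e => ρ ⬝ᵥ flat (gPair e.1.1 e.1.2))
  have hneg : ∑ e ∈ H.filter (fun e => Matched e), ρ ⬝ᵥ flat (gPair e.1.1 e.1.2) ≤ 0 :=
    Finset.sum_nonpos fun e he => (score_neg a e (Finset.mem_filter.mp he).2).le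
  have hsub : H.filter (fun e => ¬ Matched e) ⊆ Hstar n := by
    intro e he
    exact Finset.mem_filter.mpr ⟨Finset.mem_univ _, (Finset.mem_filter.mp he).2⟩
  have hmono : ∑ e ∈ H.filter (fun e => ¬ Matched e), ρ ⬝ᵥ flat (gPair e.1.1 e.1.2) ≤
      ∑ e ∈ Hstar n, ρ ⬝ᵥ flat (gPair e.1.1 e.1.2) :=
    Finset.sum_le_sum_of_subset_of_nonneg hsub fun e he _ =>
      (score_pos a e (Finset.mem_filter.mp he).2).le
  linarith

end QPair

end Summit.ValiantsHypothesis.ValiantsHypothesis.Theorems.FifoMatching.ExactPencil
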